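import Literature.NumberTheory.LFunctions.WeilExplicitFormulaProofs
import Literature.NumberTheory.LFunctions.WeilExplicitProofs
import Literature.NumberTheory.LFunctions.WeilMellinBounds
import HarnessLib

/-!
# Route WeilGroundState — crux `GroundStateSimpleEven` (stmt-RiemannHypothesis-1526), line `Sketch`:
# stub `stub_re_weilQuadratic_deriv_ge` (the zero-side lever)

Helper file (`--supports stmt-RiemannHypothesis-1526`) for the registered skeleton
`Summits/RiemannHypothesis/RiemannHypothesis/Cruxes/GroundStateSimpleEven/Lines/Sketch.lean`.

**Statement.** Assume the Riemann hypothesis and let `γ₁ > 0` be a zero-free height: every zero `s`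
of `ζ` with `Im s > 0` has `γ₁ ≤ Im s`. Then for every test function `h` (`IsWeilTest h`),
`γ₁² · Re Q(h) ≤ Re Q(h')`, where `Q = weilQuadratic` is Weil's quadratic functional
`Q(g) = W(g ⋆ g̃)`.

**Proof.** By the Guinand–Weil explicit formula (`explicit_formula_holds`, proved in the tree) both
`Q(h) = W(h ⋆ h̃)` and `Q(h') = W(h' ⋆ h̃')` are limits `T → ∞` of the truncated zero sides
`Σ_{ρ ∈ weilZeroIndex T} m(ρ) k̂(ρ)`. For an index `ρ` (a zero with `0 ≤ Re ρ ≤ 1`, `Im ρ ≠ 0`),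
RH gives `Re ρ = 1/2`, so `(h ⋆ h̃)^(ρ) = |ĥ(ρ)|²` and `(h' ⋆ h̃')^(ρ) = |(h')^(ρ)|²`
(`weilMellin_weilQuadratic_of_re_eq`), while `(h')^(ρ) = -(ρ - 1/2) ĥ(ρ)` (`weilMellin_deriv`)
and `|ρ - 1/2|² = (Im ρ)² ≥ γ₁²` (for `Im ρ < 0` apply the zero-free hypothesis to `conj ρ`,
`riemannZeta_conj`). With `m(ρ) ≥ 0` (`riemannZetaZeroOrder_nonneg`) this gives the inequality
termwise, hence for every truncation `T` (a finite sum, `weilZeroIndex_finite`), hence in the limit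
(`le_of_tendsto_of_tendsto'`).

Mathlib + the three `Literature.NumberTheory.LFunctions.WeilExplicit*`/`WeilMellinBounds` files
only; RH enters only as the hypothesis `hRH`; no named fact is used; no definitions.
-/

noncomputable section

open Set MeasureTheory Filter
open scoped Topology ComplexConjugate

namespace Summit.RiemannHypothesis.RiemannHypothesis.Theorems

open Literature.NumberTheory.LFunctions

set_option linter.dupNamespace false in
/-- **Termwise lever.** Under RH, for an index `ρ ∈ weilZeroIndex T` (a zero of `ζ` with
`0 ≤ Re ρ ≤ 1` and `Im ρ ≠ 0`, hence `Re ρ = 1/2`) and a zero-free height `γ₁ > 0`, the `ρ`-term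
of the truncated zero side of `Q(h')` dominates `γ₁²` times the `ρ`-term of `Q(h)`:
`γ₁² · m(ρ) |ĥ(ρ)|² ≤ m(ρ) |ρ - 1/2|² |ĥ(ρ)|²`, since `|ρ - 1/2|² = (Im ρ)² ≥ γ₁²` and `m(ρ) ≥ 0`. -/
private theorem stub_re_weilQuadratic_deriv_ge_term (hRH : RiemannHypothesis) {γ₁ : ℝ}
    (hγ₁ : 0 < γ₁) (hfree : ∀ s : ℂ, riemannZeta s = 0 → 0 < s.im → γ₁ ≤ s.im) {h : ℝ → ℂ}
    (hh : IsWeilTest h) {T : ℝ} {ρ : ℂ} (hρ : ρ ∈ weilZeroIndex T) :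
    γ₁ ^ 2 * ((riemannZetaZeroOrder ρ : ℂ) * weilMellin (weilConv h (weilReflect h)) ρ).re ≤
      ((riemannZetaZeroOrder ρ : ℂ) *
        weilMellin (weilConv (deriv h) (weilReflect (deriv h))) ρ).re := by
  obtain ⟨hζ, -, -, him, -⟩ := hρ
  have hne : ρ ≠ 1 := by
    rintro rfl
    simp at him
  have hre : ρ.re = 1 / 2 := by
    refine hRH ρ hζ ?_ hne
    rintro ⟨n, rfl⟩
    simp at him
  -- the zero-free height: `γ₁² ≤ (Im ρ)²`
  have hγ : γ₁ ^ 2 ≤ ρ.im ^ 2 := by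
    rcases lt_or_gt_of_ne him with hlt | hgt
    · have h1 : γ₁ ≤ -ρ.im := by
        have h2 := hfree (conj ρ) (by rw [riemannZeta_conj, hζ, map_zero])
          (by simpa using hlt)
        simpa using h2
      nlinarith
    · have h1 : γ₁ ≤ ρ.im := hfree ρ hζ hgt
      nlinarith
  -- `|ρ - 1/2|² = (Im ρ)²` on the critical line
  have hns : Complex.normSq (-(ρ - 1 / 2)) = ρ.im ^ 2 := by
    rw [Complex.normSq_neg, Complex.normSq_apply]
    simp [Complex.sub_re, Complex.sub_im, hre]
    ring
  rw [weilMellin_weilQuadratic_of_re_eq hh hre, weilMellin_weilQuadratic_of_re_eq hh.deriv hre,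
    weilMellin_deriv hh ρ, Complex.normSq_mul, hns]
  simp only [Complex.mul_re, Complex.intCast_re, Complex.intCast_im, Complex.ofReal_re,
    Complex.ofReal_im, mul_zero, sub_zero]
  have hm : (0 : ℝ) ≤ riemannZetaZeroOrder ρ := by exact_mod_cast riemannZetaZeroOrder_nonneg hne
  have hN : 0 ≤ Complex.normSq (weilMellin h ρ) := Complex.normSq_nonneg _
  calc γ₁ ^ 2 * ((riemannZetaZeroOrder ρ : ℝ) * Complex.normSq (weilMellin h ρ))
      = (riemannZetaZeroOrder ρ : ℝ) * Complex.normSq (weilMellin h ρ) * γ₁ ^ 2 := by ring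
    _ ≤ (riemannZetaZeroOrder ρ : ℝ) * Complex.normSq (weilMellin h ρ) * ρ.im ^ 2 :=
        mul_le_mul_of_nonneg_left hγ (mul_nonneg hm hN)
    _ = (riemannZetaZeroOrder ρ : ℝ) * (ρ.im ^ 2 * Complex.normSq (weilMellin h ρ)) := by ring

set_option linter.dupNamespace false in
/-- **Truncated lever.** Under RH and with a zero-free height `γ₁ > 0`, for every truncation height
`T`, `γ₁² · Re Σ_{ρ ∈ weilZeroIndex T} m(ρ) (h ⋆ h̃)^(ρ) ≤ Re Σ_{ρ ∈ weilZeroIndex T} m(ρ) (h' ⋆ h̃')^(ρ)`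
(the index set is finite, `weilZeroIndex_finite`; sum the termwise lever). -/
private theorem stub_re_weilQuadratic_deriv_ge_partial (hRH : RiemannHypothesis) {γ₁ : ℝ}
    (hγ₁ : 0 < γ₁) (hfree : ∀ s : ℂ, riemannZeta s = 0 → 0 < s.im → γ₁ ≤ s.im) {h : ℝ → ℂ}
    (hh : IsWeilTest h) (T : ℝ) :
    γ₁ ^ 2 * (weilZeroSidePartial (weilConv h (weilReflect h)) T).re ≤
      (weilZeroSidePartial (weilConv (deriv h) (weilReflect (deriv h))) T).re := by
  have hfin := weilZeroIndex_finite T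
  unfold weilZeroSidePartial
  rw [finsum_mem_eq_finite_toFinset_sum _ hfin, finsum_mem_eq_finite_toFinset_sum _ hfin,
    Complex.re_sum, Complex.re_sum, Finset.mul_sum]
  exact Finset.sum_le_sum fun ρ hρ ↦
    stub_re_weilQuadratic_deriv_ge_term hRH hγ₁ hfree hh (hfin.mem_toFinset.1 hρ)

set_option linter.dupNamespace false in
/-- **STUB Z of line `Sketch` (the zero-side lever; card lemma (ii)).** Assume the Riemann
hypothesis and let `γ₁ > 0` be a zero-free height (every zero `s` of `ζ` with `Im s > 0` has
`γ₁ ≤ Im s`). Then for every test function `h`, `γ₁² · Re Q(h) ≤ Re Q(h')`: by the explicit formula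
(`explicit_formula_holds`) both sides are limits of truncated zero sums; on the critical line
`(g ⋆ g̃)^(ρ) = |ĝ(ρ)|²` (`weilMellin_weilQuadratic_of_re_eq`) and `(h')^(ρ) = -(ρ - 1/2) ĥ(ρ)`
(`weilMellin_deriv`), so each term of `Q(h')` is `(Im ρ)² ≥ γ₁²` times the corresponding term of
`Q(h)` (multiplicities `riemannZetaZeroOrder ρ ≥ 0`); pass to the limit `T → ∞`. -/
theorem stub_re_weilQuadratic_deriv_ge (hRH : RiemannHypothesis) {γ₁ : ℝ} (hγ₁ : 0 < γ₁)
    (hfree : ∀ s : ℂ, riemannZeta s = 0 → 0 < s.im → γ₁ ≤ s.im) {h : ℝ → ℂ} (hh : IsWeilTest h) :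
    γ₁ ^ 2 * (weilQuadratic h).re ≤ (weilQuadratic (deriv h)).re := by
  have hk₁ : IsWeilTest (weilConv h (weilReflect h)) := hh.weilConv hh.weilReflect
  have hk₂ : IsWeilTest (weilConv (deriv h) (weilReflect (deriv h))) :=
    hh.deriv.weilConv hh.deriv.weilReflect
  have hlim₁ : Tendsto (fun T ↦ γ₁ ^ 2 * (weilZeroSidePartial (weilConv h (weilReflect h)) T).re)
      atTop (𝓝 (γ₁ ^ 2 * (weilQuadratic h).re)) :=
    ((Complex.continuous_re.tendsto _).comp (explicit_formula_holds hk₁)).const_mul _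
  have hlim₂ : Tendsto
      (fun T ↦ (weilZeroSidePartial (weilConv (deriv h) (weilReflect (deriv h))) T).re) atTop
      (𝓝 (weilQuadratic (deriv h)).re) :=
    (Complex.continuous_re.tendsto _).comp (explicit_formula_holds hk₂)
  exact le_of_tendsto_of_tendsto' hlim₁ hlim₂ fun T ↦
    stub_re_weilQuadratic_deriv_ge_partial hRH hγ₁ hfree hh T

end Summit.RiemannHypothesis.RiemannHypothesis.Theorems

end
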